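import Literature.Analysis.Asymptotics.LinearRecurrenceQuadraticSource
import Literature.Probability.RandomPlanarGeometry.HexSAWStripWidthThreeHatThirdContactAnnihilator
import Literature.Probability.RandomPlanarGeometry.HexSAWStripWidthThreeContactAsymptotics
import HarnessLib

/-!
# The width-three strip at criticality: the cube-weighted contact hat sums `Ĉ³(k)` grow CUBICALLY with forced leading coefficient `c³A` and the next two
# coefficients explicit in the lower-moment data (module «WIDTH-THREE THIRD CONTACT MOMENT»)

Topic `Literature/Probability/RandomPlanarGeometry` (continues «WIDTH-THREE CONTACT ASYMPTOTICS» — `W3.limDThree`, `W3.cThree`, `W3.linQThree`,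
`W3.exists_hatC2D_three_quadratic`, the scalars `W3.tOneThree … W3.tyyThree`, `W3.sum_coeff_qMonicThree_diff`, `W3.abs_sum_mul_shift_le` —, «WIDTH-THREE HAT THIRD
CONTACT ANNIHILATOR» — `W3.hatC3D`, `W3.detYDDDot`, `W3.detY_contact_cube_annihilator` — and the model-free «LINEAR RECURRENCE WITH QUADRATIC SOURCE» —
`Literature.Analysis.exists_abs_sub_cubic_le_of_linearRecurrence_one_real`).  Lane «pcv-sawmu» (CriticalPhenomena venture), a-p2 g29 — step 2 of 3 towards the third
contact cumulant `κ₃` of `S₃` (PREREG Am. BO blind cell P-BO-1).  Frame: W. Feller I (1968) XIII.6; R. P. Stanley EC1 (2012) §4.1.  Nothing below is printed.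

## What is proved (namespace `…SAW.HV.W3`; `y₃ = stripYT 3`, `A = limDThree a b`, `R = 97/100`)
* §1 Four more scalars of `det P` at `(1, y₃)`: `tThreeThree` (`Σ r(r−1)(r−2)t_r`), `trryThree` (`Σ r²ṫ_r`), `tlyyThree` (`Σ rẗ_r`), `tyyyThree` (`Σ t⃛_r`);
  `sum_coeff_sq_qMonicThree` (`Σ_j j²Q_j = T_λλλ/3 + T_λλ/2`).
* §2 The source coefficients `cubSrc2Three/cubSrc1Three/cubSrc0Three` and the cubic-law constants `cubAThree/cubBThree/cubCThree` (explicit in `A, m₀, m₂`).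
* §3 `hatC3D_three_source`, `hatC3D_three_recurrence_bound` (the `(X−1)Q` recurrence of `Ĉ³` with its quadratic source and geometric error).
* §4 ★★★ **`exists_hatC3D_three_cubic`**: `∃ m₀ m₂ m₃ K`, the linear law of `Ĉ`, the quadratic law of `Ĉ²` AND
  `|Ĉ³(n+1)_{ab} − (α/3·n³ + (β−α)/2·n² + (α/6 − β/2 + γ)·n + m₃)| ≤ K(n+1)^{92}Rⁿ` with `α = cubAThree A` (`α/3 = c³A`), `β = cubBThree A m₀`, `γ = cubCThree A m₀ m₂`.

Label: LANE THEOREM (own result of lane «pcv-sawmu», a-p2 g29, 2026-08-28; not in print).  NOT claimed: the third central moment law and `κ₃` (next module).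
-/

noncomputable section

open Finset Filter Topology Matrix Polynomial Literature.Probability.LatticeModels Literature.Probability.Percolation

namespace Literature.Probability.RandomPlanarGeometry.SAW

namespace HV

namespace W3

/-! ## §1 Four more scalars and `Σ_j j²Q_j` -/

/-- `T_λλλ := Σ_r r(r−1)(r−2)·t_r(y₃)`. [cite: Stanley2012EC1, §4.1 Theorem 4.1.1; lane «pcv-sawmu» a-p2 g29] -/
def tThreeThree : ℝ := ∑ r ∈ range 25, (r : ℝ) * ((r : ℝ) - 1) * ((r : ℝ) - 2) * detY (stripYT 3) r

/-- `Σ_r r²·ṫ_r(y₃)`. [cite: Feller1968, XIII.6; lane «pcv-sawmu» a-p2 g29] -/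
def trryThree : ℝ := ∑ r ∈ range 25, (r : ℝ) ^ 2 * detYDot (stripYT 3) r

/-- `Σ_r r·ẗ_r(y₃)`. [cite: Feller1968, XIII.6; lane «pcv-sawmu» a-p2 g29] -/
def tlyyThree : ℝ := ∑ r ∈ range 25, (r : ℝ) * detYDDot (stripYT 3) r

/-- `T_yyy := Σ_r t⃛_r(y₃)` (`= (y∂_y)³ det P(1; y)` at `y₃`). [cite: Feller1968, XIII.6; lane «pcv-sawmu» a-p2 g29] -/
def tyyyThree : ℝ := ∑ r ∈ range 25, detYDDDot (stripYT 3) r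

/-- `Σ_{j ≤ 23} j²·Q_j = T_λλλ/3 + T_λλ/2` (bookkeeping with `d_m = m(m−1)(m−2)`). [cite: Stanley2012EC1, §4.1 Theorem 4.1.1; lane plumbing] -/
theorem sum_coeff_sq_qMonicThree :
    ∑ j ∈ range (qMonicThree.natDegree + 1), qMonicThree.coeff j * (j : ℂ) ^ 2 = ((tThreeThree / 3 + tTwoThree / 2 : ℝ) : ℂ) := by
  obtain ⟨_, hdeg⟩ := qMonicThree_monic
  have hd := sum_coeff_mul_qMonicThree
  rw [hdeg] at hd ⊢
  have h := sum_coeff_X_sub_one_mul qMonicThree hdeg (fun m => (m : ℂ) * ((m : ℂ) - 1) * ((m : ℂ) - 2)) 0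
  have lhs : ∑ j ∈ range 24, qMonicThree.coeff j * ((fun m : ℕ => (m : ℂ) * ((m : ℂ) - 1) * ((m : ℂ) - 2)) (0 + 1 + j))
      - ∑ j ∈ range 24, qMonicThree.coeff j * ((fun m : ℕ => (m : ℂ) * ((m : ℂ) - 1) * ((m : ℂ) - 2)) (0 + j))
      = 3 * ∑ j ∈ range 24, qMonicThree.coeff j * (j : ℂ) ^ 2 - 3 * ∑ j ∈ range 24, qMonicThree.coeff j * (j : ℂ) := by
    rw [Finset.mul_sum, Finset.mul_sum, ← Finset.sum_sub_distrib, ← Finset.sum_sub_distrib]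
    refine Finset.sum_congr rfl fun j _ => ?_
    push_cast; ring
  have rhs : ∑ r ∈ range 25, ((X - C 1) * qMonicThree).coeff r * ((fun m : ℕ => (m : ℂ) * ((m : ℂ) - 1) * ((m : ℂ) - 2)) (0 + r))
      = ((tThreeThree : ℝ) : ℂ) := by
    unfold tThreeThree
    rw [Complex.ofReal_sum]
    refine Finset.sum_congr rfl fun r hr => ?_
    rw [X_sub_one_mul_qMonicThree_coeff r (Finset.mem_range.1 hr)]
    push_cast; ring
  have e : 3 * ∑ j ∈ range 24, qMonicThree.coeff j * (j : ℂ) ^ 2 - 3 * ∑ j ∈ range 24, qMonicThree.coeff j * (j : ℂ) = ((tThreeThree : ℝ) : ℂ) :=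
    lhs.symm.trans (h.trans rhs)
  rw [show (23 : ℕ) + 1 = 24 from rfl] at hd
  rw [hd] at e
  push_cast at e ⊢
  linear_combination e / 3

/-! ## §2 The source coefficients and the cubic-law constants -/

/-- `ℓ₂ˢ(A) := −3c²A·T_y` — the `n²` coefficient of the source of the `Ĉ³` recurrence. [cite: Feller1968, XIII.6; lane «pcv-sawmu» a-p2 g29] -/
def cubSrc2Three (A : ℝ) : ℝ := -3 * (cThree ^ 2 * A) * tyThree

/-- `ℓ₁ˢ(A, m₀) := −6c²A·T_λy − 3ℓ·T_y − 3cA·T_yy` with `ℓ = linQThree A m₀`. [cite: Feller1968, XIII.6; lane «pcv-sawmu» a-p2 g29] -/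
def cubSrc1Three (A m₀ : ℝ) : ℝ := -6 * (cThree ^ 2 * A) * tlyThree - 3 * linQThree A m₀ * tyThree - 3 * (cThree * A) * tyyThree

/-- `ℓ₀ˢ(A, m₀, m₂) := −3c²A·Σr²ṫ − 3ℓ·T_λy − 3m₂T_y − 3cA·Σrẗ − 3m₀T_yy − T_yyy·A`. [cite: Feller1968, XIII.6; lane «pcv-sawmu» a-p2 g29] -/
def cubSrc0Three (A m₀ m₂ : ℝ) : ℝ :=
  -3 * (cThree ^ 2 * A) * trryThree - 3 * linQThree A m₀ * tlyThree - 3 * m₂ * tyThree - 3 * (cThree * A) * tlyyThree - 3 * m₀ * tyyThree - tyyyThree * A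

/-- `α = ℓ₂ˢ/T_λ` (`= 3c³A`). [cite: Stanley2012EC1, §4.1 Theorem 4.1.1; lane «pcv-sawmu» a-p2 g29] -/
def cubAThree (A : ℝ) : ℝ := cubSrc2Three A / tOneThree

/-- `β = (ℓ₁ˢ − α·T_λλ)/T_λ`. [cite: Stanley2012EC1, §4.1 Theorem 4.1.1; lane «pcv-sawmu» a-p2 g29] -/
def cubBThree (A m₀ : ℝ) : ℝ := (cubSrc1Three A m₀ - cubAThree A * tTwoThree) / tOneThree

/-- `γ = (ℓ₀ˢ − α(T_λλλ/3 + T_λλ/2) − β·T_λλ/2)/T_λ`. [cite: Stanley2012EC1, §4.1 Theorem 4.1.1; lane «pcv-sawmu» a-p2 g29] -/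
def cubCThree (A m₀ m₂ : ℝ) : ℝ :=
  (cubSrc0Three A m₀ m₂ - cubAThree A * (tThreeThree / 3 + tTwoThree / 2) - cubBThree A m₀ * (tTwoThree / 2)) / tOneThree

/-! ## §3 The recurrence of `Ĉ³` with its source -/

/-- The source of the `Ĉ³` recurrence in terms of the errors of the lower moments (`e₂ = Ĉ² − (c²A·m² + ℓm + m₂)`, `e₁ = Ĉ − (cA·m + m₀)`, `e₀ = D̂ − A`):
`Σ_r t_rĈ³(n+r+1) − (ℓ₂ˢn² + ℓ₁ˢn + ℓ₀ˢ) = −(3Σ_r ṫ_re₂(n+r) + 3Σ_r ẗ_re₁(n+r) + Σ_r t⃛_re₀(n+r))` (from `detY_contact_cube_annihilator`).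
[cite: Feller1968, XIII.6; lane «pcv-sawmu» a-p2 g29] -/
theorem hatC3D_three_source (a b : Fin (2 * 3)) (m₀ m₂ : ℝ) (n : ℕ) :
    ∑ r ∈ range 25, detY (stripYT 3) r * hatC3D (stripYT 3) (n + r + 1) a b
        - (cubSrc2Three (limDThree a b) * (n : ℝ) ^ 2 + cubSrc1Three (limDThree a b) m₀ * (n : ℝ) + cubSrc0Three (limDThree a b) m₀ m₂)
      = -(3 * ∑ r ∈ range 25, detYDot (stripYT 3) r * (hatC2D (stripYT 3) (n + r + 1) a b
            - (cThree ^ 2 * limDThree a b * ((n + r : ℕ) : ℝ) ^ 2 + linQThree (limDThree a b) m₀ * ((n + r : ℕ) : ℝ) + m₂))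
          + 3 * ∑ r ∈ range 25, detYDDot (stripYT 3) r * (hatCD (stripYT 3) (n + r + 1) a b - (cThree * limDThree a b * ((n + r : ℕ) : ℝ) + m₀))
          + ∑ r ∈ range 25, detYDDDot (stripYT 3) r * (hatD 3 (stripYT 3) (n + r + 1) a b - limDThree a b)) := by
  have hy : 0 < stripYT 3 := by linarith [stripYT_three_bounds.1]
  have h := detY_contact_cube_annihilator hy a b n
  set A := limDThree a b with hA
  set ℓ := linQThree A m₀ with hℓ
  have e2 : ∑ r ∈ range 25, detYDot (stripYT 3) r * (hatC2D (stripYT 3) (n + r + 1) a b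
        - (cThree ^ 2 * A * ((n + r : ℕ) : ℝ) ^ 2 + ℓ * ((n + r : ℕ) : ℝ) + m₂))
      = ∑ r ∈ range 25, detYDot (stripYT 3) r * hatC2D (stripYT 3) (n + 1 + r) a b
        - (cThree ^ 2 * A * ((n : ℝ) ^ 2 * tyThree + 2 * (n : ℝ) * tlyThree + trryThree) + ℓ * ((n : ℝ) * tyThree + tlyThree) + m₂ * tyThree) := by
    rw [tyThree, tlyThree, trryThree]
    simp only [Finset.mul_sum, ← Finset.sum_add_distrib, ← Finset.sum_sub_distrib, mul_add]
    refine Finset.sum_congr rfl fun r _ => ?_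
    rw [show n + r + 1 = n + 1 + r by ring]; push_cast; ring
  have e1 : ∑ r ∈ range 25, detYDDot (stripYT 3) r * (hatCD (stripYT 3) (n + r + 1) a b - (cThree * A * ((n + r : ℕ) : ℝ) + m₀))
      = ∑ r ∈ range 25, detYDDot (stripYT 3) r * hatCD (stripYT 3) (n + 1 + r) a b
        - (cThree * A * ((n : ℝ) * tyyThree + tlyyThree) + m₀ * tyyThree) := by
    rw [tyyThree, tlyyThree]
    simp only [Finset.mul_sum, ← Finset.sum_add_distrib, ← Finset.sum_sub_distrib, mul_add]
    refine Finset.sum_congr rfl fun r _ => ?_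
    rw [show n + r + 1 = n + 1 + r by ring]; push_cast; ring
  have e0 : ∑ r ∈ range 25, detYDDDot (stripYT 3) r * (hatD 3 (stripYT 3) (n + r + 1) a b - A)
      = ∑ r ∈ range 25, detYDDDot (stripYT 3) r * hatD 3 (stripYT 3) (n + 1 + r) a b - tyyyThree * A := by
    rw [tyyyThree, Finset.sum_mul, ← Finset.sum_sub_distrib]
    exact Finset.sum_congr rfl fun r _ => by rw [show n + r + 1 = n + 1 + r by ring]; ring
  have e3 : ∑ r ∈ range 25, detY (stripYT 3) r * hatC3D (stripYT 3) (n + r + 1) a b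
      = ∑ r ∈ range 25, detY (stripYT 3) r * hatC3D (stripYT 3) (n + 1 + r) a b :=
    Finset.sum_congr rfl fun r _ => by rw [show n + r + 1 = n + 1 + r by ring]
  rw [e2, e1, e0, e3, cubSrc2Three, cubSrc1Three, cubSrc0Three]
  linear_combination h

/-- The recurrence-with-source estimate for `Ĉ³(n+1)_{ab}` in the form consumed by «LINEAR RECURRENCE WITH QUADRATIC SOURCE».
[cite: Feller1968, XIII.6; Stanley2012EC1, §4.1 Theorem 4.1.1 (iii); lane «pcv-sawmu» a-p2 g29] -/
theorem hatC3D_three_recurrence_bound (a b : Fin (2 * 3)) {m₀ m₂ K₁ K₂ : ℝ} (hK₁ : 0 ≤ K₁) (hK₂ : 0 ≤ K₂)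
    (hb₁ : ∀ n : ℕ, |hatCD (stripYT 3) (n + 1) a b - (cThree * limDThree a b * (n : ℝ) + m₀)| ≤ K₁ * ((n : ℝ) + 1) ^ 46 * (97 / 100 : ℝ) ^ n)
    (hb₂ : ∀ n : ℕ, |hatC2D (stripYT 3) (n + 1) a b - (cThree ^ 2 * limDThree a b * (n : ℝ) ^ 2 + linQThree (limDThree a b) m₀ * (n : ℝ) + m₂)|
      ≤ K₂ * ((n : ℝ) + 1) ^ 69 * (97 / 100 : ℝ) ^ n) :
    ∃ K : ℝ, 0 ≤ K ∧ ∀ n : ℕ,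
    ‖∑ j ∈ range (qMonicThree.natDegree + 1), qMonicThree.coeff j
        * (((hatC3D (stripYT 3) (n + 1 + j + 1) a b : ℝ) : ℂ) - ((hatC3D (stripYT 3) (n + j + 1) a b : ℝ) : ℂ))
        - (((cubSrc2Three (limDThree a b) : ℝ) : ℂ) * (n : ℂ) ^ 2 + ((cubSrc1Three (limDThree a b) m₀ : ℝ) : ℂ) * (n : ℂ)
          + ((cubSrc0Three (limDThree a b) m₀ m₂ : ℝ) : ℂ))‖
      ≤ K * ((n : ℝ) + 1) ^ 69 * (97 / 100 : ℝ) ^ n := by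
  obtain ⟨K₀, hK₀⟩ := abs_hatD_three_sub_lim_le
  have hK₀' : 0 ≤ K₀ := nonneg_of_abs_hatD_bound (hK₀ a b)
  set S₂ : ℝ := K₂ * ∑ r ∈ range 25, |detYDot (stripYT 3) r| * ((r : ℝ) + 1) ^ 69 with hS₂
  set S₁ : ℝ := K₁ * ∑ r ∈ range 25, |detYDDot (stripYT 3) r| * ((r : ℝ) + 1) ^ 46 with hS₁
  set S₀ : ℝ := K₀ * ∑ r ∈ range 25, |detYDDDot (stripYT 3) r| * ((r : ℝ) + 1) ^ 23 with hS₀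
  have hS₂0 : 0 ≤ S₂ := mul_nonneg hK₂ (Finset.sum_nonneg fun r _ => by positivity)
  have hS₁0 : 0 ≤ S₁ := mul_nonneg hK₁ (Finset.sum_nonneg fun r _ => by positivity)
  have hS₀0 : 0 ≤ S₀ := mul_nonneg hK₀' (Finset.sum_nonneg fun r _ => by positivity)
  refine ⟨3 * S₂ + 3 * S₁ + S₀, by linarith, fun n => ?_⟩
  rw [sum_coeff_qMonicThree_diff (fun m => hatC3D (stripYT 3) (m + 1) a b) n]
  rw [← Complex.ofReal_natCast, ← Complex.ofReal_pow, ← Complex.ofReal_mul, ← Complex.ofReal_mul, ← Complex.ofReal_add, ← Complex.ofReal_add,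
    ← Complex.ofReal_sub, Complex.norm_real, Real.norm_eq_abs, hatC3D_three_source a b m₀ m₂ n, abs_neg]
  have h2 := abs_sum_mul_shift_le (g := fun r => detYDot (stripYT 3) r)
    (e := fun m => hatC2D (stripYT 3) (m + 1) a b - (cThree ^ 2 * limDThree a b * (m : ℝ) ^ 2 + linQThree (limDThree a b) m₀ * (m : ℝ) + m₂))
    (by norm_num) (by norm_num) hK₂ hb₂ n
  have h1 := abs_sum_mul_shift_le (g := fun r => detYDDot (stripYT 3) r)
    (e := fun m => hatCD (stripYT 3) (m + 1) a b - (cThree * limDThree a b * (m : ℝ) + m₀)) (by norm_num) (by norm_num) hK₁ hb₁ n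
  have h0 := abs_sum_mul_shift_le (g := fun r => detYDDDot (stripYT 3) r) (e := fun m => hatD 3 (stripYT 3) (m + 1) a b - limDThree a b)
    (by norm_num) (by norm_num) hK₀' (hK₀ a b) n
  rw [← hS₂] at h2
  rw [← hS₁] at h1
  rw [← hS₀] at h0
  have hn1 : (1 : ℝ) ≤ (n : ℝ) + 1 := by linarith [(Nat.cast_nonneg n : (0 : ℝ) ≤ n)]
  have hp1 : ((n : ℝ) + 1) ^ 46 * (97 / 100 : ℝ) ^ n ≤ ((n : ℝ) + 1) ^ 69 * (97 / 100 : ℝ) ^ n :=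
    mul_le_mul_of_nonneg_right (pow_le_pow_right₀ hn1 (by norm_num)) (by positivity)
  have hp0 : ((n : ℝ) + 1) ^ 23 * (97 / 100 : ℝ) ^ n ≤ ((n : ℝ) + 1) ^ 69 * (97 / 100 : ℝ) ^ n :=
    mul_le_mul_of_nonneg_right (pow_le_pow_right₀ hn1 (by norm_num)) (by positivity)
  have h1' := h1.trans (mul_le_mul_of_nonneg_left hp1 hS₁0)
  have h0' := h0.trans (mul_le_mul_of_nonneg_left hp0 hS₀0)
  set X₂ := ∑ r ∈ range 25, detYDot (stripYT 3) r * (hatC2D (stripYT 3) (n + r + 1) a b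
      - (cThree ^ 2 * limDThree a b * ((n + r : ℕ) : ℝ) ^ 2 + linQThree (limDThree a b) m₀ * ((n + r : ℕ) : ℝ) + m₂)) with hX₂
  set X₁ := ∑ r ∈ range 25, detYDDot (stripYT 3) r * (hatCD (stripYT 3) (n + r + 1) a b - (cThree * limDThree a b * ((n + r : ℕ) : ℝ) + m₀)) with hX₁
  set X₀ := ∑ r ∈ range 25, detYDDDot (stripYT 3) r * (hatD 3 (stripYT 3) (n + r + 1) a b - limDThree a b) with hX₀
  set W := ((n : ℝ) + 1) ^ 69 * (97 / 100 : ℝ) ^ n with hW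
  calc |3 * X₂ + 3 * X₁ + X₀| ≤ |3 * X₂ + 3 * X₁| + |X₀| := abs_add_le _ _
    _ ≤ (|3 * X₂| + |3 * X₁|) + |X₀| := by gcongr; exact abs_add_le _ _
    _ = 3 * |X₂| + 3 * |X₁| + |X₀| := by rw [abs_mul, abs_mul, abs_of_pos (by norm_num : (0 : ℝ) < 3)]
    _ ≤ 3 * (S₂ * W) + 3 * (S₁ * W) + S₀ * W := by gcongr
    _ = (3 * S₂ + 3 * S₁ + S₀) * ((n : ℝ) + 1) ^ 69 * (97 / 100 : ℝ) ^ n := by rw [hW]; ring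

/-! ## §4 The cubic law of `Ĉ³` -/

/-- ★★★ **The cube-weighted contact hat sums grow cubically with forced leading coefficient `c³A_{ab}`.**  For all levels `a, b` there are `m₀, m₂, m₃, K`
with the linear law of `Ĉ` (`K(n+1)^{46}Rⁿ`), the quadratic law of `Ĉ²` (`K(n+1)^{69}Rⁿ`) and
`|Ĉ³(n+1)_{ab} − (α/3·n³ + (β−α)/2·n² + (α/6 − β/2 + γ)·n + m₃)| ≤ K(n+1)^{92}Rⁿ`, `α = cubAThree A`, `β = cubBThree A m₀`, `γ = cubCThree A m₀ m₂`
(`α/3 = c³A`).  Proof: «THIRD CONTACT ANNIHILATOR» gives the `(X−1)Q` recurrence of `Ĉ³` with source `ℓ₂ˢn² + ℓ₁ˢn + ℓ₀ˢ + O((n+1)^{69}Rⁿ)`; «LINEAR RECURRENCE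
WITH QUADRATIC SOURCE». [cite: Feller1968, XIII.6 (moments of the number of renewals); Stanley2012EC1, §4.1 Theorem 4.1.1 (iii); lane «pcv-sawmu» a-p2 g29 — own result, not in print] -/
theorem exists_hatC3D_three_cubic (a b : Fin (2 * 3)) :
    ∃ m₀ m₂ m₃ K : ℝ,
      (∀ n : ℕ, |hatCD (stripYT 3) (n + 1) a b - (cThree * limDThree a b * (n : ℝ) + m₀)| ≤ K * ((n : ℝ) + 1) ^ 46 * (97 / 100 : ℝ) ^ n) ∧
      (∀ n : ℕ, |hatC2D (stripYT 3) (n + 1) a b - (cThree ^ 2 * limDThree a b * (n : ℝ) ^ 2 + linQThree (limDThree a b) m₀ * (n : ℝ) + m₂)|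
        ≤ K * ((n : ℝ) + 1) ^ 69 * (97 / 100 : ℝ) ^ n) ∧
      ∀ n : ℕ, |hatC3D (stripYT 3) (n + 1) a b - (cubAThree (limDThree a b) / 3 * (n : ℝ) ^ 3
          + (cubBThree (limDThree a b) m₀ - cubAThree (limDThree a b)) / 2 * (n : ℝ) ^ 2
          + (cubAThree (limDThree a b) / 6 - cubBThree (limDThree a b) m₀ / 2 + cubCThree (limDThree a b) m₀ m₂) * (n : ℝ) + m₃)|
        ≤ K * ((n : ℝ) + 1) ^ 92 * (97 / 100 : ℝ) ^ n := by
  obtain ⟨hQm, hdeg⟩ := qMonicThree_monic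
  have hT : tOneThree ≠ 0 := (exists_hatCD_three_linear a b).1
  obtain ⟨m₀, m₂, K₁, hb₁, hb₂⟩ := exists_hatC2D_three_quadratic a b
  have hK₁ : 0 ≤ K₁ := by
    have h := hb₁ 0
    simp only [Nat.cast_zero, zero_add, mul_zero, one_pow, pow_zero, mul_one] at h
    exact (abs_nonneg _).trans h
  obtain ⟨K₂, hK₂, hw⟩ := hatC3D_three_recurrence_bound a b hK₁ hK₁ hb₁ hb₂
  set A := limDThree a b with hA
  have hα : cubAThree A * tOneThree = cubSrc2Three A := by rw [cubAThree]; field_simp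
  have hβ : cubBThree A m₀ * tOneThree = cubSrc1Three A m₀ - 2 * cubAThree A * (tTwoThree / 2) := by rw [cubBThree]; field_simp
  have hγ : cubCThree A m₀ m₂ * tOneThree = cubSrc0Three A m₀ m₂ - cubAThree A * (tThreeThree / 3 + tTwoThree / 2) - cubBThree A m₀ * (tTwoThree / 2) := by
    rw [cubCThree]; field_simp
  obtain ⟨m₃, K₃, hK₃, hb₃⟩ := Literature.Analysis.exists_abs_sub_cubic_le_of_linearRecurrence_one_real
    (w := fun m => hatC3D (stripYT 3) (m + 1) a b) hQm (by norm_num) (by norm_num) (fun z hz => qMonicThree_root_norm_le hz)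
    sum_coeff_qMonicThree sum_coeff_mul_qMonicThree sum_coeff_sq_qMonicThree hα hβ hγ hK₂ hw
  refine ⟨m₀, m₂, m₃, max K₁ K₃, fun n => (hb₁ n).trans ?_, fun n => (hb₂ n).trans ?_, fun n => ?_⟩
  · gcongr; exact le_max_left _ _
  · gcongr; exact le_max_left _ _
  have h := hb₃ n
  rw [hdeg] at h
  exact h.trans (by gcongr; exact le_max_right _ _)

end W3

end HV

end Literature.Probability.RandomPlanarGeometry.SAW
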